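import Literature.Analysis.FluidPDE.PlanarNoAnomalousDissipation
import HarnessLib

/-!
# No anomalous dissipation in forced two-dimensional flows with vortex-sheet data
# (Elgindi–Lopes Filho–Nussenzveig Lopes 2025, Theorems 5.2, 6.1, 6.4)

T. M. Elgindi, M. C. Lopes Filho, H. J. Nussenzveig Lopes, *Absence of anomalous dissipation for vortex
sheets*, arXiv:2504.18523 (v1, 25 Apr 2025, 24 pp.; the only version; page numbers below are those of
the arXiv PDF, page-confirmed 2026-08-27). [`ElgindiLopesNussenzveig2025`]

Named facts (Literature is sorry-free, D-0014): `ElgindiLopesNussenzveig2025_thm52`, `_thm61`,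
`_thm64` are `def … : Prop`. Sequel of `PlanarNoAnomalousDissipation.lean` (De Rosa–Park 2024, the
UNFORCED statements), whose vocabulary (`Torus.HasWeakPlanarCurl`, `Torus.HasWeakPlanarCurlDecomp`,
`DeRosaPark2024.NoAnomalousDissipation`) is reused; the present source treats flows WITH FORCING
`F^ν ⇀ F` weakly in `L²_t L²_x` — the situation of the summit's forced Navier–Stokes equations, in two
dimensions — and proves the absence of anomalous dissipation by a refinement of Nash's inequality,
with a rate (Remark 6.6). Source, p. 3: "our work applies to flows with forcing, and it allows for more
general ways in which initial data may be approximated … provides a rate of vanishing of dissipation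
with respect to viscosity."

## Source, verbatim (arXiv:2504.18523v1)

* (1.1) p. 2: `∂ₜu^ν + (u^ν·∇)u^ν = -∇p^ν + νΔu^ν + F^ν`, `div u^ν = 0` on `𝕋² × (0,T)`, `u^ν(·,0) = u₀^ν`,
  `𝕋² = [-π,π]²`; (1.3) `ζ^ν ≡ ν∫∫|ω^ν|² dx dt`, `ω^ν = curl u^ν`; "A sequence of solutions `{u^ν}`
  for which `lim_{ν→0} ζ^ν > 0` is said to exhibit anomalous dissipation."
* **Theorem 5.2** (p. 13): "Fix `T > 0`. Let `{u₀^ν}_{ν>0}` be a family of divergence-free vector fields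
  in `L²(𝕋²)`. Let `u^ν ∈ L^∞(0,T; L²(𝕋²)) ∩ L²(0,T; H¹(𝕋²))` be the solution to 2D Navier-Stokes with
  viscosity `ν`, with initial data `u₀^ν`, and forcing `F^ν ∈ L²(0,T; L²(𝕋²))`. Set `ω^ν ≡ curl u^ν`.
  Assume the following conditions: H(a) `u₀^ν → u₀` strongly in `L²(𝕋²)`; H(b) `F^ν ⇀ F` weakly in
  `L²(0,T; L²(𝕋²))`; H(c) `ω^ν` is bounded in `L^∞(0,T; L¹(𝕋²))`. If additionally
  `lim_{r→0⁺} sup_{ν>0} sup_{t∈(0,T)} sup_{z∈𝕋²} ∫_{|x-z|<r} |ω^ν| dx = 0` (5.3), then, passing to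
  subsequences as needed, `u^ν` converges, weak-∗ `L^∞(0,T; L²(𝕋²))`, to a (physically realizable)
  weak solution of 2D Euler with initial data `u₀` and `limsup_{ν→0⁺} ν∫₀ᵀ ‖ω^ν(·,t)‖²_{L²} dt = 0`."
* §6 p. 17, standing: "Fix `T > 0` and let `u^ν ∈ L^∞(0,T;L²(𝕋²)) ∩ L²(0,T;H¹(𝕋²))` be the solution to
  the 2D Navier-Stokes equations (1.1) with divergence-free initial data `u₀^ν ∈ L²(𝕋²)` and forcing
  `F^ν ∈ L²(0,T;L²(𝕋²))`. Assume hypotheses H(a) and H(b) hold true. Let `ω₀^ν = curl u₀^ν`."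
* **Theorem 6.1** (p. 17): "Let `ω^ν ≡ curl u^ν`. Suppose that H1(a) `{ω₀^ν}_{ν>0}` is weakly compact
  in `L¹(𝕋²)`; H1(b) for almost every `τ ∈ (0,T)`, `{curl F^ν(·,τ)}_{ν>0}` is weakly compact in
  `L¹(𝕋²)` and `∫₀ᵀ sup_{ν>0} ‖curl F^ν(·,τ)‖_{L¹} dτ < ∞`. Then we have:
  `limsup_{ν→0⁺} ν∫₀ᵀ ‖ω^ν(τ)‖²_{L²} dτ = 0`."
* **Theorem 6.4** (p. 19): "Fix `p > 1`. Let `ω^ν ≡ curl u^ν`. Assume, in addition to H(a) and H(b),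
  that H2(a) `ω₀^ν = μ₀^ν + w₀^ν`, with `{μ₀^ν}_{ν>0}` bounded in `BM(𝕋²)`, `μ₀^ν ≥ 0`, and
  `{w₀^ν}_{ν>0}` bounded in `L^p(𝕋²)`; H2(b) `{curl F^ν}_{ν>0}` bounded in `L¹(0,T; L^p(𝕋²))`. Then
  `limsup_{ν→0⁺} ν∫₀ᵀ ‖ω^ν(τ)‖²_{L²} dτ = 0`." Remark 6.6 (p. 20): under these hypotheses the rate
  `ζ^ν_δ(T) ≲ |log ν|^{-1/4}` as `ν → 0⁺` (6.4).
* Corollary 6.7 (p. 20; `BM₊ + L¹`, proof "omitted") is NOT typed (see 6. below).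

## Rendering (faithfulness notes; deviations are WEAKENINGS and are recorded)

1. As in `PlanarNoAnomalousDissipation.lean`: unit torus `𝕋² = UnitAddTorus (Fin 2)` (the source's
   `[-π,π]²`; the parabolic rescaling `x = 2πx'`, `t = 4π²t'`, `u' = 2πu`, `F' = 8π³F`, same `ν`,
   maps (1.1) to (1.1) and preserves every hypothesis class and the conclusion, the window `T` being
   arbitrary), families indexed by `ν ∈ (0,1)` with limits along `𝓝[>] 0`, Leray–Hopf solutions
   `Torus.IsLerayHopfOn T ν (F ν) (u₀ ν) (u ν)` WITH FORCE `F ν` (in 2D with `L²` data and `L²_tL²_x`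
   force the Leray solution is unique, so "the solution" = every tree solution), vorticities as weak
   planar curls (`Torus.HasWeakPlanarCurl`, a.e. in `t` for the solution), and the conclusion
   `limsup ν∫₀ᵀ‖ω^ν‖² = 0` = `DeRosaPark2024.NoAnomalousDissipation T u` (`‖∇u‖₂ = ‖ω‖₂` for
   divergence-free fields on `𝕋²`; the tree functional is the spectral `‖∇u^ν(t)‖²`).
2. H(a): `u₀^ν → u₀` in `L²` along `ν → 0⁺` for some `u₀ ∈ L²` (`IsStronglyConvergentData`).
   H(b): `F^ν ⇀ F` weakly in `L²((0,T) × 𝕋²; ℝ²)` along `ν → 0⁺`: tested against every space–time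
   square-integrable field `g`, together with the UNIFORM bound `sup_ν ‖F^ν‖_{L²_tL²_x} < ∞` that weak
   sequential convergence carries (first line of the proof of Thm. 5.2: "from hypotheses H(a), H(b)
   and H(c), we have `‖u₀^ν‖_{L²} + ‖ω^ν‖_{L^∞_tL¹_x} + ‖F^ν‖_{L²_tL²_x} ≤ K`") and which a filter
   limit over `ν ∈ (0,1)` does not imply by itself — made explicit (`IsWeaklyConvergentForcing T F`).
3. H(c) and (5.3) as in `DeRosaPark2024_thm51`, but (5.3) is the printed UNIFORM (`sup_ν sup_t sup_z`)
   smallness of the vorticity mass of `r`-disks, `ELN2025.uniformVorticityConcentration`, with the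
   limit `r → 0⁺`; balls of the product metric of `𝕋²` (equivalent to Euclidean disks up to `√2` in
   the radius, immaterial for the limit). The Euler-limit clause of Thm. 5.2 (weak-∗ convergence along
   subsequences to a physically realizable weak Euler solution) is NOT transcribed — only the
   dissipation conclusion (weakening by omission, as for De Rosa–Park's (T1)).
4. Thm. 6.1: H1(a) "weakly compact in `L¹`" = equi-integrable and `L¹`-bounded (Dunford–Pettis), i.e.
   Mathlib's `UniformIntegrable (fun ν : Ioo 0 1 => ω₀ ν) 1 volume` (as in `DeRosaPark2024_thm14_T2`);
   H1(b): weak planar curls `g ν τ` of `F ν τ` for a.e. `τ` (all `ν`), uniformly integrable in `ν` at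
   a.e. `τ`, with `∫₀ᵀ sup_ν ‖g ν τ‖_{L¹} dτ < ∞` (lower integral of the `⨆`).
5. Thm. 6.4: H2(a) via `Torus.HasWeakPlanarCurlDecomp (u₀ ν) (w₀ ν) (μ₀ ν)` (`curl u₀^ν = w₀^ν dx + μ₀^ν`,
   `μ₀^ν ≥ 0` a finite measure) with `μ₀ ν (𝕋²) ≤ K` and `‖w₀ ν‖_{L^p} ≤ K`; H2(b):
   `∫₀ᵀ ‖curl F^ν(τ)‖_{L^p} dτ ≤ K` for weak curls `g ν τ` (a.e. `τ`). `p > 1` real, `L^p` = `eLpNorm · p`.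
   The rate of Remark 6.6 is a remark (`≲`, through the non-explicit (5.15)) and is not typed.
6. NOT typed: Cor. 6.7 (`BM₊ + L¹`; printed with `{w₀^ν}` merely BOUNDED in `L¹` and proof omitted —
   the typed Thm. 6.1 needs weak compactness for the same step, so the corollary is left out rather
   than risk a misprint as a fact), Prop. 3.2 / 4.2 (the refined Nash inequalities), §7.

## References

* T. M. Elgindi, M. C. Lopes Filho, H. J. Nussenzveig Lopes, arXiv:2504.18523v1 (2025): (1.1)–(1.3)
  p. 2, Thm. 5.2 p. 13 (proof pp. 13–17), Thm. 6.1 p. 17, Thm. 6.4 p. 19, Rmk. 6.6 and Cor. 6.7 p. 20.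
  [`ElgindiLopesNussenzveig2025`]
* L. De Rosa, J. Park, arXiv:2403.04668v3 (the unforced statements; `PlanarNoAnomalousDissipation.lean`).
  [`DeRosaPark2024`]
-/

open MeasureTheory Set Filter Topology Function Metric
open scoped ENNReal NNReal

namespace Literature.Analysis.FluidPDE

noncomputable section

open Literature.Analysis.FunctionSpaces DeRosaPark2024

namespace ELN2025

/-- **H(a)** (Thm. 5.2 p. 13): `u₀^ν → u₀` strongly in `L²(𝕋²)` as `ν → 0⁺`, for a family `ν ↦ u₀ ν`
on `ν ∈ (0,1)` of `L²` fields and some `L²` limit `u₀`.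
[cite: ElgindiLopesNussenzveig2025, Thm. 5.2 H(a) p. 13] -/
def IsStronglyConvergentData (u₀ : ℝ → UnitAddTorus (Fin 2) → EuclideanSpace ℝ (Fin 2)) : Prop :=
  (∀ ν ∈ Ioo (0 : ℝ) 1, MemLp (u₀ ν) 2 volume) ∧
    ∃ v : UnitAddTorus (Fin 2) → EuclideanSpace ℝ (Fin 2), MemLp v 2 volume ∧
      Tendsto (fun ν => eLpNorm (u₀ ν - v) 2 volume) (𝓝[>] 0) (𝓝 0)

/-- **H(b)** (Thm. 5.2 p. 13): `F^ν ⇀ F` weakly in `L²(0,T; L²(𝕋²))` as `ν → 0⁺` — every `F ν` and the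
limit `F` are space–time measurable and square integrable on `(0,T) × 𝕋²`, the family is UNIFORMLY
bounded there (module docstring 2.), and `∫₀ᵀ∫ ⟪F^ν - F, g⟫ → 0` for every square-integrable test field
`g`. [cite: ElgindiLopesNussenzveig2025, Thm. 5.2 H(b) p. 13] -/
def IsWeaklyConvergentForcing (T : ℝ)
    (F : ℝ → ℝ → UnitAddTorus (Fin 2) → EuclideanSpace ℝ (Fin 2)) : Prop :=
  (∀ ν ∈ Ioo (0 : ℝ) 1,
      AEStronglyMeasurable (Torus.stLift (F ν)) (volume.restrict (Ioo 0 T ×ˢ univ))) ∧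
  (∃ K : ℝ≥0∞, K < ⊤ ∧ ∀ ν ∈ Ioo (0 : ℝ) 1, ∫⁻ t in Ioo 0 T, ∫⁻ x, ‖F ν t x‖ₑ ^ 2 ≤ K) ∧
  ∃ Flim : ℝ → UnitAddTorus (Fin 2) → EuclideanSpace ℝ (Fin 2),
    AEStronglyMeasurable (Torus.stLift Flim) (volume.restrict (Ioo 0 T ×ˢ univ)) ∧
    ∫⁻ t in Ioo 0 T, ∫⁻ x, ‖Flim t x‖ₑ ^ 2 < ⊤ ∧
    ∀ g : ℝ → UnitAddTorus (Fin 2) → EuclideanSpace ℝ (Fin 2),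
      AEStronglyMeasurable (Torus.stLift g) (volume.restrict (Ioo 0 T ×ˢ univ)) →
      ∫⁻ t in Ioo 0 T, ∫⁻ x, ‖g t x‖ₑ ^ 2 < ⊤ →
        Tendsto (fun ν => ∫ t in Ioo 0 T, ∫ x, inner ℝ (F ν t x - Flim t x) (g t x)) (𝓝[>] 0) (𝓝 0)

/-- **The uniform vorticity-concentration functional of (5.3)** (Thm. 5.2 p. 13) at radius `r`:
`sup_{ν} sup_{t∈(0,T)} sup_{z∈𝕋²} ∫_{|x-z|<r} |ω^ν(x,t)| dx ∈ [0,∞]` (balls of the metric of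
`UnitAddTorus (Fin 2)`; `ν ∈ (0,1)`). [cite: ElgindiLopesNussenzveig2025, Thm. 5.2 (5.3) p. 13] -/
def uniformVorticityConcentration (T : ℝ) (ω : ℝ → ℝ → UnitAddTorus (Fin 2) → ℝ) (r : ℝ) : ℝ≥0∞ :=
  ⨆ ν ∈ Ioo (0 : ℝ) 1, ⨆ t ∈ Ioo (0 : ℝ) T, ⨆ z : UnitAddTorus (Fin 2), ∫⁻ x in ball z r, ‖ω ν t x‖ₑ

end ELN2025

open ELN2025

/-- **Elgindi–Lopes Filho–Nussenzveig Lopes 2025, Theorem 5.2 (dissipation conclusion)**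
(arXiv:2504.18523v1 p. 13; module docstring *Source* and 1.–3.). Let `T > 0`; let `ν ↦ u₀ ν`
(`ν ∈ (0,1)`) be divergence-free `L²(𝕋²)` data converging strongly in `L²` as `ν → 0⁺` (H(a)); let
`F ν ∈ L²(0,T;L²)` converge weakly in `L²_tL²_x` (with the uniform bound; H(b)); let `u ν` be the
Leray–Hopf solutions of the FORCED 2D Navier–Stokes equations on `𝕋² × [0,T)` with viscosity `ν`,
force `F ν` and datum `u₀ ν`; let the vorticities `ω ν t = curl (u ν t)` (weak planar curls, a.e. `t`)
be bounded in `L^∞(0,T;L¹)` (H(c)) and satisfy the uniform no-concentration condition (5.3),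
`sup_ν sup_t sup_z ∫_{B_r(z)} |ω^ν| → 0` as `r → 0⁺`. Then `limsup_{ν→0⁺} ν∫₀ᵀ‖ω^ν‖²_{L²} = 0`
(`NoAnomalousDissipation T u`). The Euler-limit clause is not transcribed.
[cite: ElgindiLopesNussenzveig2025, Thm. 5.2 p. 13 (H(a)–H(c), (5.3))] -/
def ElgindiLopesNussenzveig2025_thm52 : Prop :=
  ∀ (T : ℝ) (u₀ : ℝ → UnitAddTorus (Fin 2) → EuclideanSpace ℝ (Fin 2))
    (F u : ℝ → ℝ → UnitAddTorus (Fin 2) → EuclideanSpace ℝ (Fin 2))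
    (ω : ℝ → ℝ → UnitAddTorus (Fin 2) → ℝ), 0 < T →
    (∀ ν ∈ Ioo (0 : ℝ) 1, Torus.IsWeaklyDivFree (u₀ ν)) →
    IsStronglyConvergentData u₀ →
    IsWeaklyConvergentForcing T F →
    (∀ ν ∈ Ioo (0 : ℝ) 1, Torus.IsLerayHopfOn T ν (F ν) (u₀ ν) (u ν)) →
    (∀ ν ∈ Ioo (0 : ℝ) 1, ∀ᵐ t ∂(volume.restrict (Ioo 0 T)), Torus.HasWeakPlanarCurl (u ν t) (ω ν t)) →
    (∃ M : ℝ≥0∞, M < ⊤ ∧ ∀ ν ∈ Ioo (0 : ℝ) 1,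
      ∀ᵐ t ∂(volume.restrict (Ioo 0 T)), ∫⁻ x, ‖ω ν t x‖ₑ ≤ M) →
    Tendsto (uniformVorticityConcentration T ω) (𝓝[>] 0) (𝓝 0) →
    NoAnomalousDissipation T u

/-- **Elgindi–Lopes Filho–Nussenzveig Lopes 2025, Theorem 6.1 (no anomalous dissipation for
integrable vorticity data and forcing)** (arXiv:2504.18523v1 p. 17; module docstring 1., 2., 4.). Let
`T > 0`; data `u₀ ν` divergence free in `L²`, H(a); forces `F ν`, H(b); Leray–Hopf solutions `u ν` with
force `F ν`. Suppose H1(a): the initial vorticities `ω₀ ν = curl (u₀ ν)` are `L¹` functions forming a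
relatively weakly compact family in `L¹(𝕋²)` (`UniformIntegrable … 1 volume`), and H1(b): for a.e.
`τ ∈ (0,T)` the curls `g ν τ = curl (F ν τ)` form a relatively weakly compact family in `L¹(𝕋²)` and
`∫₀ᵀ sup_ν ‖curl F^ν(τ)‖_{L¹} dτ < ∞`. Then `limsup_{ν→0⁺} ν∫₀ᵀ‖ω^ν‖²_{L²} = 0`.
[cite: ElgindiLopesNussenzveig2025, Thm. 6.1 p. 17 (H1(a)–H1(b)); §6 standing hypotheses p. 17] -/
def ElgindiLopesNussenzveig2025_thm61 : Prop :=
  ∀ (T : ℝ) (u₀ : ℝ → UnitAddTorus (Fin 2) → EuclideanSpace ℝ (Fin 2))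
    (ω₀ : ℝ → UnitAddTorus (Fin 2) → ℝ)
    (F u : ℝ → ℝ → UnitAddTorus (Fin 2) → EuclideanSpace ℝ (Fin 2))
    (g : ℝ → ℝ → UnitAddTorus (Fin 2) → ℝ), 0 < T →
    (∀ ν ∈ Ioo (0 : ℝ) 1, Torus.IsWeaklyDivFree (u₀ ν)) →
    IsStronglyConvergentData u₀ →
    IsWeaklyConvergentForcing T F →
    (∀ ν ∈ Ioo (0 : ℝ) 1, Torus.IsLerayHopfOn T ν (F ν) (u₀ ν) (u ν)) →
    (∀ ν ∈ Ioo (0 : ℝ) 1, Torus.HasWeakPlanarCurl (u₀ ν) (ω₀ ν)) →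
    UniformIntegrable (fun ν : Ioo (0 : ℝ) 1 => ω₀ ν) 1 volume →
    (∀ ν ∈ Ioo (0 : ℝ) 1, ∀ᵐ τ ∂(volume.restrict (Ioo 0 T)), Torus.HasWeakPlanarCurl (F ν τ) (g ν τ)) →
    (∀ᵐ τ ∂(volume.restrict (Ioo 0 T)), UniformIntegrable (fun ν : Ioo (0 : ℝ) 1 => g ν τ) 1 volume) →
    (∫⁻ τ in Ioo 0 T, ⨆ ν ∈ Ioo (0 : ℝ) 1, ∫⁻ x, ‖g ν τ x‖ₑ) < ⊤ →
    NoAnomalousDissipation T u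

/-- **Elgindi–Lopes Filho–Nussenzveig Lopes 2025, Theorem 6.4 (no anomalous dissipation for vortex
sheets of distinguished sign plus `L^p`, with forcing)** (arXiv:2504.18523v1 p. 19; module docstring
1., 2., 5.). Fix `p > 1` and `T > 0`; data `u₀ ν` divergence free in `L²`, H(a); forces `F ν`, H(b);
Leray–Hopf solutions `u ν` with force `F ν`. Suppose H2(a): `curl (u₀ ν) = w₀ ν dx + μ₀ ν` with
nonnegative finite measures `μ₀ ν` of bounded mass and `{w₀ ν}` bounded in `L^p(𝕋²)`, and H2(b):
`{curl F^ν}` bounded in `L¹(0,T; L^p(𝕋²))` (weak curls `g ν τ`, a.e. `τ`). Then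
`limsup_{ν→0⁺} ν∫₀ᵀ‖ω^ν‖²_{L²} = 0` (with the rate `≲ |log ν|^{-1/4}` of Remark 6.6, not typed).
[cite: ElgindiLopesNussenzveig2025, Thm. 6.4 p. 19 (H2(a)–H2(b)); §6 standing hypotheses p. 17] -/
def ElgindiLopesNussenzveig2025_thm64 : Prop :=
  ∀ (p : ℝ≥0∞), 1 < p → p < ⊤ →
  ∀ (T : ℝ) (u₀ : ℝ → UnitAddTorus (Fin 2) → EuclideanSpace ℝ (Fin 2))
    (w₀ : ℝ → UnitAddTorus (Fin 2) → ℝ) (μ₀ : ℝ → Measure (UnitAddTorus (Fin 2)))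
    (F u : ℝ → ℝ → UnitAddTorus (Fin 2) → EuclideanSpace ℝ (Fin 2))
    (g : ℝ → ℝ → UnitAddTorus (Fin 2) → ℝ), 0 < T →
    (∀ ν ∈ Ioo (0 : ℝ) 1, Torus.IsWeaklyDivFree (u₀ ν)) →
    IsStronglyConvergentData u₀ →
    IsWeaklyConvergentForcing T F →
    (∀ ν ∈ Ioo (0 : ℝ) 1, Torus.IsLerayHopfOn T ν (F ν) (u₀ ν) (u ν)) →
    (∀ ν ∈ Ioo (0 : ℝ) 1, Torus.HasWeakPlanarCurlDecomp (u₀ ν) (w₀ ν) (μ₀ ν)) →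
    (∃ K : ℝ≥0∞, K < ⊤ ∧ ∀ ν ∈ Ioo (0 : ℝ) 1,
      μ₀ ν univ ≤ K ∧ eLpNorm (w₀ ν) p volume ≤ K) →
    (∀ ν ∈ Ioo (0 : ℝ) 1, ∀ᵐ τ ∂(volume.restrict (Ioo 0 T)), Torus.HasWeakPlanarCurl (F ν τ) (g ν τ)) →
    (∃ K : ℝ≥0∞, K < ⊤ ∧ ∀ ν ∈ Ioo (0 : ℝ) 1, ∫⁻ τ in Ioo 0 T, eLpNorm (g ν τ) p volume ≤ K) →
    NoAnomalousDissipation T u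

end

end Literature.Analysis.FluidPDE
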